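import Summits.AnomalousDissipation.AnomalousDissipation.Theorems.StirringSphereEnsembleRealizationStubRestart
import Literature.Analysis.FluidPDE.NSGalerkinFamilyWeakForm
import Mathlib.MeasureTheory.Integral.IntervalIntegral.AbsolutelyContinuousFun
import Mathlib.MeasureTheory.Integral.IntervalIntegral.LebesgueDifferentiationThm

/-!
# Crux `EnsembleRealization` (stmt-AnomalousDissipation-0215) — line `augmented-lift`,
# stub `stub_augWeakForm` (M2b), tools: the Galerkin weak identity of ONE field

Supports stmt-AnomalousDissipation-0215 (registered tools stub `stub_augWeakFormTools`, used by
`stub_augWeakForm` of line `augmented-lift` in `StirringSphereEnsembleRealizationStubAugWeakForm.lean`).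
Nothing here closes an item.

Main result `galerkin_weak_identity_of_modewise` (= `stub_augWeakFormTools`): a space–time measurable
field `v` with `L²` slices bounded in `L²` which satisfies the MODEWISE integrated Navier–Stokes
identities `(v t, a) − (v s, a) = ∫ₛᵗ (⟪v, (v·∇)a⟫ + ν⟪v, Δa⟫ + ⟪f, a⟫)` against the Galerkin modes
`a` of order `M` satisfies the Galerkin equations in weak form against the truncation `P_M ψ` of every
divergence-free space–time test field `ψ` (the one-field version of the tree's
`IsHopfGalerkinFamily.galerkin_weak_identity`, Robinson–Rodrigo–Sadowski 2016, Thm. 4.4 Step 4).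
Ingredients: integration by parts in time for the absolutely continuous pairings `t ↦ (v t, a)`
(`intervalIntegral_ibp_of_sub_eq_integral`: Mathlib's FTC and integration by parts for absolutely
continuous functions, Lebesgue differentiation), measurability and integrability in time of the
tested right-hand sides (Fubini), sup bounds for weak-form slice functionals of `L²` fields
(`norm_sliceFunctional_le`, `norm_sliceFunctional_trunc_sub_le`), and the transversal frames of
`NSHopfGalerkinLimit` (`Torus.fourierTruncate_eq_sum_frame`).
-/

noncomputable section

set_option linter.dupNamespace false

open MeasureTheory TopologicalSpace Set Function Filter Topology InnerProductSpace UnitAddTorus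
open scoped RealInnerProductSpace ENNReal NNReal

namespace Summit.AnomalousDissipation.AnomalousDissipation.Theorems.EnsembleRealization

open Literature.Analysis.FunctionSpaces Literature.Analysis.FunctionSpaces.Torus
open Literature.Analysis.FluidPDE Literature.Analysis.FluidPDE.Torus

open scoped BigOperators InnerProductSpace

variable {ν : ℝ} {f : UnitAddTorus (Fin 3) → EuclideanSpace ℝ (Fin 3)}

/-! ### Integration by parts against an absolutely continuous pairing -/

/-- **Integration by parts in time for an integrated identity.** If `G(t) - G(0) = ∫₀ᵗ h` on
`[0, T]` with `h` integrable on `(0, T)`, and `λ ∈ C¹(ℝ)` with `λ(T) = 0`, then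
`t ↦ λ' G + λ h` is integrable on `[0, T]` and `∫₀ᵀ (λ' G + λ h) = -λ(0) G(0)` (FTC and
integration by parts for absolutely continuous functions, Mathlib's `AbsolutelyContinuousOnInterval`:
`G` is the sum of a constant and a primitive, `deriv G = h` a.e. by Lebesgue differentiation). -/
theorem intervalIntegral_ibp_of_sub_eq_integral {G h lam lam' : ℝ → ℝ} {T : ℝ} (hT : 0 < T)
    (hh : IntervalIntegrable h volume 0 T) (hG : ∀ t ∈ Icc 0 T, G t - G 0 = ∫ τ in 0..t, h τ)
    (hlam : ∀ t, HasDerivAt lam (lam' t) t) (hlam' : Continuous lam') (hlamT : lam T = 0) :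
    IntervalIntegrable (fun t => lam' t * G t + lam t * h t) volume 0 T ∧
      ∫ t in 0..T, (lam' t * G t + lam t * h t) = -(lam 0 * G 0) := by
  have h0T : (0 : ℝ) ∈ uIcc 0 T := left_mem_uIcc
  have hIcc : uIcc 0 T = Icc 0 T := uIcc_of_le hT.le
  -- the primitive `P = G(0) + ∫₀ h` is absolutely continuous and agrees with `G` on `[0, T]`
  have hPac : AbsolutelyContinuousOnInterval (fun t => G 0 + ∫ τ in 0..t, h τ) 0 T :=
    ((LipschitzWith.const (G 0)).lipschitzOnWith).absolutelyContinuousOnInterval.fun_add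
      (hh.absolutelyContinuousOnInterval_intervalIntegral h0T)
  have hPG : ∀ t ∈ uIcc 0 T, G 0 + ∫ τ in 0..t, h τ = G t := fun t ht => by
    rw [← hG t (hIcc ▸ ht)]; ring
  -- `λ` is `C¹`, hence absolutely continuous
  have hdl : deriv lam = lam' := funext fun t => (hlam t).deriv
  have hlamC : ContDiff ℝ 1 lam :=
    contDiff_one_iff_deriv.2 ⟨fun t => (hlam t).differentiableAt, hdl ▸ hlam'⟩
  have hlamAC : AbsolutelyContinuousOnInterval lam 0 T := hlamC.contDiffOn.absolutelyContinuousOnInterval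
  -- integration by parts for absolutely continuous functions; `deriv P = h` a.e. on `[0, T]`
  have hibp := hlamAC.integral_mul_deriv_eq_deriv_mul hPac
  have hPd : ∀ᵐ t, t ∈ uIoc 0 T →
      lam t * deriv (fun t => G 0 + ∫ τ in 0..t, h τ) t = lam t * h t := by
    filter_upwards [hh.ae_hasDerivAt_integral] with t ht htm
    rw [((ht (uIoc_subset_uIcc htm) 0 h0T).const_add (G 0)).deriv]
  rw [intervalIntegral.integral_congr_ae hPd, hlamT, zero_mul, zero_sub, hdl,
    intervalIntegral.integral_same, add_zero] at hibp
  -- assemble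
  have hGc : ContinuousOn G (uIcc 0 T) := hPac.continuousOn.congr fun t ht => (hPG t ht).symm
  have i1 : IntervalIntegrable (fun t => lam' t * G t) volume 0 T :=
    (hlam'.continuousOn.mul hGc).intervalIntegrable
  have i2 : IntervalIntegrable (fun t => lam t * h t) volume 0 T :=
    hh.continuousOn_mul hlamC.continuous.continuousOn
  refine ⟨i1.add i2, ?_⟩
  rw [intervalIntegral.integral_add i1 i2, hibp, intervalIntegral.integral_congr
    (fun t ht => show lam' t * (G 0 + ∫ τ in 0..t, h τ) = lam' t * G t by rw [hPG t ht])]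
  ring

/-! ### Slice functionals of `L²` fields: bounds and measurability -/

/-- A continuous real function on the torus is bounded above by a nonnegative constant. -/
theorem exists_forall_le_of_continuous {g : UnitAddTorus (Fin 3) → ℝ} (hg : Continuous g) :
    ∃ C, 0 ≤ C ∧ ∀ x, g x ≤ C := by
  obtain ⟨C, hC⟩ := isCompact_univ.exists_bound_of_continuousOn hg.continuousOn
  exact ⟨max C 0, le_max_right _ _, fun x =>
    ((le_abs_self _).trans ((Real.norm_eq_abs _).symm.trans_le (hC x (mem_univ x)))).trans (le_max_left _ _)⟩

/-- **Sup bound for the weak-form slice functional of `L²` fields**: for `U, F ∈ L²(T³)`, a smooth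
`b` with `∑ᵢ ‖∂ᵢ b‖ ≤ C` and `‖b‖ ≤ K_q`, continuous `p`, `L` with `‖p‖ ≤ K_p`, `‖L‖ ≤ K_L`,
`‖∫ (⟪U, p⟫ + ⟪U, (U·∇)b⟫ + ν⟪U, L⟫ + ⟪F, b⟫)‖ ≤`
`(K_p/2 + |ν|K_L/2 + C) ∫‖U‖² + (K_q/2) ∫‖F‖² + (K_p/2 + |ν|K_L/2 + K_q/2)`
(pointwise `abs_weakIntegrand_trunc_le`, integrated). -/
theorem norm_sliceFunctional_le {U F : UnitAddTorus (Fin 3) → EuclideanSpace ℝ (Fin 3)}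
    (hU : MemLp U 2 volume) (hF : MemLp F 2 volume) {b p L : UnitAddTorus (Fin 3) → EuclideanSpace ℝ (Fin 3)}
    (hb : IsSmooth b) {C Kp KL Kq : ℝ} (hKp0 : 0 ≤ Kp) (hKL0 : 0 ≤ KL) (hKq0 : 0 ≤ Kq)
    (hC : ∀ x, ∑ i, ‖partialDeriv i b x‖ ≤ C) (hKp : ∀ x, ‖p x‖ ≤ Kp) (hKL : ∀ x, ‖L x‖ ≤ KL)
    (hKq : ∀ x, ‖b x‖ ≤ Kq) (ν : ℝ) :
    ‖∫ x, (⟪U x, p x⟫_ℝ + ⟪U x, convect U b x⟫_ℝ + ν * ⟪U x, L x⟫_ℝ + ⟪F x, b x⟫_ℝ)‖ ≤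
      (Kp / 2 + |ν| * KL / 2 + C) * (∫ x, ‖U x‖ ^ 2) + Kq / 2 * (∫ x, ‖F x‖ ^ 2) +
        (Kp / 2 + |ν| * KL / 2 + Kq / 2) := by
  have iU : Integrable (fun x => ‖U x‖ ^ 2) volume := hU.integrable_norm_pow two_ne_zero
  have iF : Integrable (fun x => ‖F x‖ ^ 2) volume := hF.integrable_norm_pow two_ne_zero
  have i12 : Integrable (fun x => (Kp / 2 + |ν| * KL / 2 + C) * ‖U x‖ ^ 2 + Kq / 2 * ‖F x‖ ^ 2) volume :=
    (iU.const_mul _).add (iF.const_mul _)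
  have i123 : Integrable (fun x => (Kp / 2 + |ν| * KL / 2 + C) * ‖U x‖ ^ 2 + Kq / 2 * ‖F x‖ ^ 2 +
      (Kp / 2 + |ν| * KL / 2 + Kq / 2)) volume := i12.add (integrable_const _)
  refine (norm_integral_le_of_norm_le i123 (ae_of_all _ fun x => ?_)).trans (le_of_eq ?_)
  · rw [Real.norm_eq_abs]
    exact abs_weakIntegrand_trunc_le _ _ _ _ _ _ ν hKq0 hKp0 hKL0 (hKp x) (hKL x) (hKq x)
      ((norm_convect_le U (hb.isContDiff (by simp)) x).trans (mul_le_mul_of_nonneg_left (hC x) (norm_nonneg _)))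
  · rw [integral_add i12 (integrable_const _), integral_add (iU.const_mul _) (iF.const_mul _),
      integral_const_mul, integral_const_mul, integral_const]
    simp [Measure.real]

/-- **Slice bound for the truncation error of the weak-form functional of `L²` fields**: given the
uniform truncation errors `e₀, e₁, e₂` of `ψ(t), ∂ₜψ(t), Δψ(t)` and `e₃` of `∑ᵢ ‖∂ᵢψ(t) - P_M ∂ᵢψ(t)‖`,
`|Φ(ψ)(t) - Φ(P_M ψ)(t)| ≤ (e₁/2 + |ν|e₂/2 + e₃) ∫‖U‖² + (e₀/2) ∫‖F‖² + (e₁/2 + |ν|e₂/2 + e₀/2)`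
(the version of `IsHopfGalerkinScheme.norm_sliceFunctional_trunc_sub_le` for `L²` slices: the
difference is the slice functional of the truncation errors, bounded by `norm_sliceFunctional_le`). -/
theorem norm_sliceFunctional_trunc_sub_le {T : ℝ} {ψ : ℝ → UnitAddTorus (Fin 3) → EuclideanSpace ℝ (Fin 3)}
    (hψ : IsSpaceTimeTest T ψ) (M : ℕ) (t : ℝ) {U F : UnitAddTorus (Fin 3) → EuclideanSpace ℝ (Fin 3)}
    (hU : MemLp U 2 volume) (hF : MemLp F 2 volume) {e₀ e₁ e₂ e₃ : ℝ} (he₀ : 0 ≤ e₀) (he₁ : 0 ≤ e₁)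
    (he₂ : 0 ≤ e₂)
    (h₀ : ∀ x, ‖ψ t x - fourierTruncate M (ψ t) x‖ ≤ e₀)
    (h₁ : ∀ x, ‖Torus.timeDeriv ψ t x - fourierTruncate M (Torus.timeDeriv ψ t) x‖ ≤ e₁)
    (h₂ : ∀ x, ‖laplacian (ψ t) x - fourierTruncate M (laplacian (ψ t)) x‖ ≤ e₂)
    (h₃ : ∀ x, ∑ i, ‖partialDeriv i (ψ t) x - fourierTruncate M (partialDeriv i (ψ t)) x‖ ≤ e₃) (ν : ℝ) :
    ‖(∫ x, (⟪U x, Torus.timeDeriv ψ t x⟫_ℝ + ⟪U x, convect U (ψ t) x⟫_ℝ + ν * ⟪U x, laplacian (ψ t) x⟫_ℝ +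
        ⟪F x, ψ t x⟫_ℝ)) -
        ∫ x, (⟪U x, fourierTruncate M (Torus.timeDeriv ψ t) x⟫_ℝ + ⟪U x, convect U (fourierTruncate M (ψ t)) x⟫_ℝ +
          ν * ⟪U x, laplacian (fourierTruncate M (ψ t)) x⟫_ℝ + ⟪F x, fourierTruncate M (ψ t) x⟫_ℝ)‖ ≤
      (e₁ / 2 + |ν| * e₂ / 2 + e₃) * (∫ x, ‖U x‖ ^ 2) + e₀ / 2 * (∫ x, ‖F x‖ ^ 2) +
        (e₁ / 2 + |ν| * e₂ / 2 + e₀ / 2) := by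
  have hsl := hψ.isSmooth_slice t
  have hPs : IsSmooth (fourierTruncate M (ψ t)) := isSmooth_fourierTruncate _ _
  have hpc : Continuous (Torus.timeDeriv ψ t) := (hψ.timeDeriv.isSmooth_slice t).continuous
  have i1 := Torus.integrable_weakIntegrand hU hF hsl hpc hsl.laplacian.continuous ν
  have i2 := Torus.integrable_weakIntegrand hU hF hPs (continuous_fourierTruncate M (Torus.timeDeriv ψ t))
    hPs.laplacian.continuous ν
  rw [← integral_sub i1 i2]
  -- the difference is the slice functional of the truncation errors
  have hd : ∀ x, (⟪U x, Torus.timeDeriv ψ t x⟫_ℝ + ⟪U x, convect U (ψ t) x⟫_ℝ + ν * ⟪U x, laplacian (ψ t) x⟫_ℝ +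
      ⟪F x, ψ t x⟫_ℝ) - (⟪U x, fourierTruncate M (Torus.timeDeriv ψ t) x⟫_ℝ +
      ⟪U x, convect U (fourierTruncate M (ψ t)) x⟫_ℝ +
      ν * ⟪U x, laplacian (fourierTruncate M (ψ t)) x⟫_ℝ + ⟪F x, fourierTruncate M (ψ t) x⟫_ℝ) =
      ⟪U x, Torus.timeDeriv ψ t x - fourierTruncate M (Torus.timeDeriv ψ t) x⟫_ℝ +
        ⟪U x, convect U (fun y => ψ t y - fourierTruncate M (ψ t) y) x⟫_ℝ +
        ν * ⟪U x, laplacian (ψ t) x - fourierTruncate M (laplacian (ψ t)) x⟫_ℝ +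
        ⟪F x, ψ t x - fourierTruncate M (ψ t) x⟫_ℝ := by
    intro x
    rw [Torus.convect_sub_apply hsl hPs, laplacian_fourierTruncate hsl]
    simp only [inner_sub_right]
    ring
  rw [integral_congr_ae (ae_of_all _ hd)]
  refine norm_sliceFunctional_le hU hF (hsl.sub hPs) he₁ he₂ he₀ (fun x => ?_) h₁ h₂ h₀ ν
  refine le_trans (le_of_eq (Finset.sum_congr rfl fun i _ => ?_)) (h₃ x)
  rw [show (ψ t - fourierTruncate M (ψ t)) = fun y => ψ t y - fourierTruncate M (ψ t) y from rfl,
    Torus.partialDeriv_sub_apply hsl hPs, partialDeriv_fourierTruncate hsl]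

variable {v : ℝ → UnitAddTorus (Fin 3) → EuclideanSpace ℝ (Fin 3)}

/-- The tested right-hand side `τ ↦ ∫ (⟪v τ, (v τ·∇)a⟫ + ν⟪v τ, Δa⟫ + ⟪f, a⟫)` of a space–time
measurable field against a smooth steady field `a` is a.e. strongly measurable in time (Fubini). -/
theorem aestronglyMeasurable_modeRHS (hvm : AEStronglyMeasurable (stLift v) (volume.restrict (Ioi 0 ×ˢ univ)))
    {a : UnitAddTorus (Fin 3) → EuclideanSpace ℝ (Fin 3)} (ha : IsSmooth a) (hf : IsSmooth f) (ν T : ℝ) :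
    AEStronglyMeasurable (fun τ => ∫ x, (⟪v τ x, convect (v τ) a x⟫_ℝ + ν * ⟪v τ x, laplacian a x⟫_ℝ +
      ⟪f x, a x⟫_ℝ)) (volume.restrict (Ioo 0 T)) := by
  have hu' := aestronglyMeasurable_uncurry_prod_of_stLift hvm T
  have h : AEStronglyMeasurable (fun q : ℝ × UnitAddTorus (Fin 3) =>
      ⟪uncurry v q, ∑ i, (uncurry v q) i • partialDeriv i a q.2⟫_ℝ + ν * ⟪uncurry v q, laplacian a q.2⟫_ℝ +
        ⟪f q.2, a q.2⟫_ℝ) ((volume.restrict (Ioo 0 T)).prod volume) :=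
    ((hu'.inner (Finset.aestronglyMeasurable_fun_sum _ fun i _ =>
      ((EuclideanSpace.proj (𝕜 := ℝ) i).continuous.comp_aestronglyMeasurable hu').smul
        ((ha.partialDeriv i).continuous.comp continuous_snd).aestronglyMeasurable)).add
      ((hu'.inner (ha.laplacian.continuous.comp continuous_snd).aestronglyMeasurable).const_mul ν)).add
      ((hf.continuous.comp continuous_snd).aestronglyMeasurable.inner
        (ha.continuous.comp continuous_snd).aestronglyMeasurable)
  refine h.integral_prod_right'.congr (ae_of_all _ fun t => integral_congr_ae (ae_of_all _ fun x => ?_))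
  simp only [uncurry_apply_pair, Torus.convect]
  rw [fderiv_apply_eq_sum_partialDeriv (ha.isContDiff (by simp))]

/-- **Uniform bound for the tested right-hand side** along a field bounded in `L²`:
`|∫ (⟪v τ, (v τ·∇)a⟫ + ν⟪v τ, Δa⟫ + ⟪f, a⟫)| ≤ B` for all `τ ≥ 0`. -/
theorem exists_norm_modeRHS_le (hf : IsSmooth f) (hv : ∀ t, 0 ≤ t → MemLp (v t) 2 volume) {Y : ℝ}
    (hY : ∀ t, 0 ≤ t → ∫ x, ‖v t x‖ ^ 2 ≤ Y) {a : UnitAddTorus (Fin 3) → EuclideanSpace ℝ (Fin 3)}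
    (ha : IsSmooth a) (ν : ℝ) :
    ∃ B, ∀ τ, 0 ≤ τ →
      ‖∫ x, (⟪v τ x, convect (v τ) a x⟫_ℝ + ν * ⟪v τ x, laplacian a x⟫_ℝ + ⟪f x, a x⟫_ℝ)‖ ≤ B := by
  obtain ⟨C, -, hC⟩ := exists_forall_le_of_continuous
    (continuous_finsetSum Finset.univ fun i _ => (ha.partialDeriv i).continuous.norm)
  obtain ⟨KL, hKL0, hKL⟩ := exists_forall_le_of_continuous ha.laplacian.continuous.norm
  obtain ⟨Kq, hKq0, hKq⟩ := exists_forall_le_of_continuous ha.continuous.norm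
  refine ⟨(0 / 2 + |ν| * KL / 2 + C) * Y + Kq / 2 * (∫ x, ‖f x‖ ^ 2) + (0 / 2 + |ν| * KL / 2 + Kq / 2),
    fun τ hτ => ?_⟩
  have h := norm_sliceFunctional_le (p := fun _ => 0) (hv τ hτ) (hf.memLp 2) ha le_rfl hKL0 hKq0 hC
    (fun x => by simp) hKL hKq ν
  simp only [inner_zero_right, zero_add] at h
  refine h.trans ?_
  have hC0 : 0 ≤ C := (Finset.sum_nonneg fun i _ => norm_nonneg _).trans (hC 0)
  gcongr
  exact hY τ hτ

/-- The tested right-hand side is integrable in time on every `(0, T)`. -/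
theorem integrableOn_modeRHS (hf : IsSmooth f) (hvm : AEStronglyMeasurable (stLift v) (volume.restrict (Ioi 0 ×ˢ univ)))
    (hv : ∀ t, 0 ≤ t → MemLp (v t) 2 volume) {Y : ℝ} (hY : ∀ t, 0 ≤ t → ∫ x, ‖v t x‖ ^ 2 ≤ Y)
    {a : UnitAddTorus (Fin 3) → EuclideanSpace ℝ (Fin 3)} (ha : IsSmooth a) (ν T : ℝ) :
    IntegrableOn (fun τ => ∫ x, (⟪v τ x, convect (v τ) a x⟫_ℝ + ν * ⟪v τ x, laplacian a x⟫_ℝ + ⟪f x, a x⟫_ℝ))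
      (Ioo 0 T) volume := by
  obtain ⟨B, hB⟩ := exists_norm_modeRHS_le hf hv hY ha ν
  refine Integrable.mono' (integrableOn_const (C := B) measure_Ioo_lt_top.ne)
    (aestronglyMeasurable_modeRHS hvm ha hf ν T) ?_
  filter_upwards [ae_restrict_mem measurableSet_Ioo] with τ hτ using hB τ hτ.1.le

/-! ### The Galerkin equations in weak form against truncated test fields -/

/-- **The modewise identities in weak form against truncated test fields** (the version of
`IsHopfGalerkinFamily.galerkin_weak_identity` for ONE field with `L²` slices satisfying the
modewise Navier–Stokes identities against the Galerkin modes of order `M`): for every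
divergence-free space–time test field `ψ` on `[0, T)`,
`∫₀ᵀ ∫ (⟪v, P_M ∂ₜψ⟫ + ⟪v, (v·∇)P_M ψ⟫ + ν⟪v, Δ P_M ψ⟫ + ⟪f, P_M ψ⟫) + ∫ ⟪v 0, P_M ψ(0)⟫ = 0`,
the time integrand being integrable on `[0, T]`. Proof: expand `P_M ψ(t) = ∑ᵢ λᵢ(t) aᵢ` along
transversal frames (`Torus.fourierTruncate_eq_sum_frame`), integrate the one-mode identities by
parts in time (`intervalIntegral_ibp_of_sub_eq_integral`) and sum. -/
theorem galerkin_weak_identity_of_modewise (hf : IsSmooth f)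
    (hvm : AEStronglyMeasurable (stLift v) (volume.restrict (Ioi 0 ×ˢ univ)))
    (hv : ∀ t, 0 ≤ t → MemLp (v t) 2 volume) {Y : ℝ} (hY : ∀ t, 0 ≤ t → ∫ x, ‖v t x‖ ^ 2 ≤ Y) {M : ℕ}
    (hmode : ∀ a : UnitAddTorus (Fin 3) → EuclideanSpace ℝ (Fin 3), IsGalerkinMode M a → ∀ s t : ℝ, 0 ≤ s → s ≤ t →
      (∫ x, ⟪v t x, a x⟫_ℝ) - ∫ x, ⟪v s x, a x⟫_ℝ =
        ∫ τ in s..t, ∫ x, (⟪v τ x, convect (v τ) a x⟫_ℝ + ν * ⟪v τ x, laplacian a x⟫_ℝ + ⟪f x, a x⟫_ℝ))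
    {T : ℝ} (hT : 0 < T) {ψ : ℝ → UnitAddTorus (Fin 3) → EuclideanSpace ℝ (Fin 3)} (hψ : IsSpaceTimeTest T ψ)
    (hdiv : IsDivFreeTest ψ) :
    IntervalIntegrable (fun t => ∫ x, (⟪v t x, fourierTruncate M (Torus.timeDeriv ψ t) x⟫_ℝ +
        ⟪v t x, convect (v t) (fourierTruncate M (ψ t)) x⟫_ℝ + ν * ⟪v t x, laplacian (fourierTruncate M (ψ t)) x⟫_ℝ +
        ⟪f x, fourierTruncate M (ψ t) x⟫_ℝ)) volume 0 T ∧
    (∫ t in (0 : ℝ)..T, ∫ x, (⟪v t x, fourierTruncate M (Torus.timeDeriv ψ t) x⟫_ℝ +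
        ⟪v t x, convect (v t) (fourierTruncate M (ψ t)) x⟫_ℝ + ν * ⟪v t x, laplacian (fourierTruncate M (ψ t)) x⟫_ℝ +
        ⟪f x, fourierTruncate M (ψ t) x⟫_ℝ)) + ∫ x, ⟪v 0 x, fourierTruncate M (ψ 0) x⟫_ℝ = 0 := by
  classical
  -- transversal frames and coordinate functionals
  choose fr hfrT hfr using fun k : Fin 3 → ℤ => Torus.exists_transversal_frame (d := Fin 3) k
  choose C hC using fun l : Fin 3 × Bool => Torus.exists_coordCLM (d := Fin 3) l
  set I : Finset ((Fin 3 → ℤ) × (Fin 3 × Bool)) := freqBall M ×ˢ Finset.univ with hI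
  set a : (Fin 3 → ℤ) × (Fin 3 × Bool) → UnitAddTorus (Fin 3) → EuclideanSpace ℝ (Fin 3) :=
    fun i => realTrigPoly {i.1} (fun _ => fr i.1 i.2) with ha
  have ha_mode : ∀ i ∈ I, IsGalerkinMode M (a i) := fun i hi =>
    isGalerkinMode_realTrigPoly_singleton (Finset.mem_product.1 hi).1 (hfrT i.1 i.2)
  have ha_smooth : ∀ i, IsSmooth (a i) := fun i => isSmooth_realTrigPoly _ _
  -- coefficients and their derivatives
  set lam : ℝ → (Fin 3 → ℤ) × (Fin 3 × Bool) → ℝ :=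
    fun t i => C i.2 (mFourierCoeff (EuclideanSpace.complexify ∘ ψ t) i.1) with hlam
  set lam' : ℝ → (Fin 3 → ℤ) × (Fin 3 × Bool) → ℝ :=
    fun t i => C i.2 (mFourierCoeff (EuclideanSpace.complexify ∘ Torus.timeDeriv ψ t) i.1) with hlam'
  have hderiv : ∀ i t, HasDerivAt (fun s => lam s i) (lam' t i) t := fun i t =>
    (C i.2).hasFDerivAt.comp_hasDerivAt t (hasDerivAt_mFourierCoeff_slice (hψ.isSmoothSpaceTimeOn univ) i.1 t)
  have hcont' : ∀ i, Continuous fun t => lam' t i := fun i =>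
    (C i.2).continuous.comp (hψ.timeDeriv.continuous_mFourierCoeff i.1)
  have hlamT : ∀ i, lam T i = 0 := by
    intro i
    simp only [hlam, hψ.eq_zero_of_le le_rfl]
    have : mFourierCoeff (EuclideanSpace.complexify ∘ (0 : UnitAddTorus (Fin 3) → EuclideanSpace ℝ (Fin 3))) i.1 = 0 := by
      simp [mFourierCoeff]
    rw [this, map_zero]
  -- the representations of the truncations
  have hR : ∀ t x, fourierTruncate M (ψ t) x = ∑ i ∈ I, lam t i • a i x := by
    intro t x
    rw [Torus.fourierTruncate_eq_sum_frame hfr (fun k =>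
      IsDivFree.sum_mul_mFourierCoeff_eq_zero (hψ.isSmooth_slice t) (hdiv t) k)]
    refine Finset.sum_congr rfl fun i _ => ?_
    simp only [hlam, ha, hC]
  have hR' : ∀ t x, fourierTruncate M (Torus.timeDeriv ψ t) x = ∑ i ∈ I, lam' t i • a i x := by
    intro t x
    rw [Torus.fourierTruncate_eq_sum_frame hfr (fun k => hψ.sum_mul_mFourierCoeff_timeDeriv_eq_zero hdiv k t)]
    refine Finset.sum_congr rfl fun i _ => ?_
    simp only [hlam', ha, hC]
  have hRfun : ∀ t, fourierTruncate M (ψ t) = fun x => ∑ i ∈ I, lam t i • a i x := fun t => funext (hR t)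
  -- the mode pairings and their tested right-hand sides
  set G : (Fin 3 → ℤ) × (Fin 3 × Bool) → ℝ → ℝ := fun i t => ∫ x, ⟪v t x, a i x⟫_ℝ with hG
  set h : (Fin 3 → ℤ) × (Fin 3 × Bool) → ℝ → ℝ := fun i t =>
    ∫ x, (⟪v t x, convect (v t) (a i) x⟫_ℝ + ν * ⟪v t x, laplacian (a i) x⟫_ℝ + ⟪f x, a i x⟫_ℝ) with hh
  have hhi : ∀ i, IntervalIntegrable (h i) volume 0 T := fun i =>
    (intervalIntegrable_iff_integrableOn_Ioo_of_le hT.le).2 (integrableOn_modeRHS hf hvm hv hY (ha_smooth i) ν T)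
  have hGi : ∀ i ∈ I, ∀ t ∈ Icc (0 : ℝ) T, G i t - G i 0 = ∫ τ in 0..t, h i τ := fun i hi t ht =>
    hmode (a i) (ha_mode i hi) 0 t le_rfl ht.1
  -- the one-mode identities integrated by parts, summed
  have hibp : ∀ i ∈ I, IntervalIntegrable (fun t => lam' t i * G i t + lam t i * h i t) volume 0 T ∧
      ∫ t in (0 : ℝ)..T, (lam' t i * G i t + lam t i * h i t) = -(lam 0 i * G i 0) := fun i hi =>
    intervalIntegral_ibp_of_sub_eq_integral hT (hhi i) (hGi i hi) (hderiv i) (hcont' i) (hlamT i)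
  have hsum := Finset.sum_congr rfl fun i (hi : i ∈ I) => (hibp i hi).2
  have hint : ∀ i ∈ I, IntervalIntegrable (fun t => lam' t i * G i t + lam t i * h i t) volume 0 T :=
    fun i hi => (hibp i hi).1
  rw [← intervalIntegral.integral_finsetSum hint] at hsum
  -- identify the right-hand side
  have hv0i : Integrable (v 0) volume := (hv 0 le_rfl).integrable one_le_two
  have hrhs : ∑ i ∈ I, -(lam 0 i * G i 0) = -∫ x, ⟪v 0 x, fourierTruncate M (ψ 0) x⟫_ℝ := by
    rw [Finset.sum_neg_distrib, neg_inj]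
    simp_rw [hR 0, inner_sum, inner_smul_right]
    rw [integral_finsetSum I fun i _ => (Torus.integrable_inner_of_continuous hv0i (ha_smooth i).continuous).const_mul _]
    exact Finset.sum_congr rfl fun i _ => (integral_const_mul _ _).symm
  -- identify the left-hand side, slice by slice
  have hlhs : ∀ t ∈ Icc (0 : ℝ) T, ∑ i ∈ I, (lam' t i * G i t + lam t i * h i t) =
      ∫ x, (⟪v t x, fourierTruncate M (Torus.timeDeriv ψ t) x⟫_ℝ + ⟪v t x, convect (v t) (fourierTruncate M (ψ t)) x⟫_ℝ +
        ν * ⟪v t x, laplacian (fourierTruncate M (ψ t)) x⟫_ℝ + ⟪f x, fourierTruncate M (ψ t) x⟫_ℝ) := by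
    intro t ht
    have hvt : MemLp (v t) 2 volume := hv t ht.1
    have hvti : Integrable (v t) volume := hvt.integrable one_le_two
    have iA : ∀ i, Integrable (fun x => ⟪v t x, a i x⟫_ℝ) volume := fun i =>
      Torus.integrable_inner_of_continuous hvti (ha_smooth i).continuous
    have iB : ∀ i, Integrable (fun x => ⟪v t x, convect (v t) (a i) x⟫_ℝ + ν * ⟪v t x, laplacian (a i) x⟫_ℝ +
        ⟪f x, a i x⟫_ℝ) volume := by
      intro i
      have h4 := Torus.integrable_weakIntegrand (p := fun _ => 0) hvt (hf.memLp 2) (ha_smooth i) continuous_const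
        (ha_smooth i).laplacian.continuous ν
      simpa only [inner_zero_right, zero_add] using h4
    have hstep : ∀ i ∈ I, lam' t i * G i t + lam t i * h i t =
        ∫ x, (lam' t i * ⟪v t x, a i x⟫_ℝ + lam t i * (⟪v t x, convect (v t) (a i) x⟫_ℝ +
          ν * ⟪v t x, laplacian (a i) x⟫_ℝ + ⟪f x, a i x⟫_ℝ)) := by
      intro i _
      rw [integral_add ((iA i).const_mul _) ((iB i).const_mul _), integral_const_mul, integral_const_mul]
    have iAB : ∀ i ∈ I, Integrable (fun x => lam' t i * ⟪v t x, a i x⟫_ℝ + lam t i * (⟪v t x, convect (v t) (a i) x⟫_ℝ +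
        ν * ⟪v t x, laplacian (a i) x⟫_ℝ + ⟪f x, a i x⟫_ℝ)) volume := fun i _ =>
      ((iA i).const_mul _).add ((iB i).const_mul _)
    rw [Finset.sum_congr rfl hstep, ← integral_finsetSum I iAB]
    refine integral_congr_ae (ae_of_all _ fun x => ?_)
    dsimp only
    rw [hR' t x, hRfun t, Torus.convect_finset_sum_smul I (lam t) ha_smooth,
      Torus.laplacian_finset_sum_smul I (lam t) ha_smooth]
    simp only [inner_sum, inner_smul_right, Finset.mul_sum, ← Finset.sum_add_distrib]
    refine Finset.sum_congr rfl fun i _ => ?_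
    ring
  refine ⟨(IntervalIntegrable.sum I hint).congr fun t ht => ?_, ?_⟩
  · rw [Finset.sum_apply]
    exact hlhs t (Ioc_subset_Icc_self (by rwa [uIoc_of_le hT.le] at ht))
  · rw [intervalIntegral.integral_congr (fun t ht => hlhs t (by rwa [uIcc_of_le hT.le] at ht)), hrhs] at hsum
    linarith

/-! ### Registered tools stub -/

/-- **Tools stub (registered as `stub_augWeakFormTools` on stmt-AnomalousDissipation-0215).**
The Galerkin equations in weak form against truncated test fields for ONE field with `L²` slices
bounded in `L²` satisfying the modewise Navier–Stokes identities against the Galerkin modes of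
order `M` (= `galerkin_weak_identity_of_modewise` on `T³`). -/
theorem stub_augWeakFormTools (ν' T Y : ℝ) (M : ℕ) (f' : UnitAddTorus (Fin 3) → EuclideanSpace ℝ (Fin 3))
    (w : ℝ → UnitAddTorus (Fin 3) → EuclideanSpace ℝ (Fin 3)) (ψ : ℝ → UnitAddTorus (Fin 3) → EuclideanSpace ℝ (Fin 3))
    (hf : IsSmooth f') (hwm : AEStronglyMeasurable (stLift w) (volume.restrict (Ioi 0 ×ˢ univ)))
    (hw : ∀ t, 0 ≤ t → MemLp (w t) 2 volume) (hY : ∀ t, 0 ≤ t → ∫ x, ‖w t x‖ ^ 2 ≤ Y)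
    (hmode : ∀ a : UnitAddTorus (Fin 3) → EuclideanSpace ℝ (Fin 3), IsGalerkinMode M a → ∀ s t : ℝ, 0 ≤ s → s ≤ t →
      (∫ x, ⟪w t x, a x⟫_ℝ) - ∫ x, ⟪w s x, a x⟫_ℝ =
        ∫ τ in s..t, ∫ x, (⟪w τ x, convect (w τ) a x⟫_ℝ + ν' * ⟪w τ x, laplacian a x⟫_ℝ + ⟪f' x, a x⟫_ℝ))
    (hT : 0 < T) (hψ : IsSpaceTimeTest T ψ) (hdiv : IsDivFreeTest ψ) :
    IntervalIntegrable (fun t => ∫ x, (⟪w t x, fourierTruncate M (Torus.timeDeriv ψ t) x⟫_ℝ +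
        ⟪w t x, convect (w t) (fourierTruncate M (ψ t)) x⟫_ℝ + ν' * ⟪w t x, laplacian (fourierTruncate M (ψ t)) x⟫_ℝ +
        ⟪f' x, fourierTruncate M (ψ t) x⟫_ℝ)) volume 0 T ∧
      (∫ t in (0 : ℝ)..T, ∫ x, (⟪w t x, fourierTruncate M (Torus.timeDeriv ψ t) x⟫_ℝ +
        ⟪w t x, convect (w t) (fourierTruncate M (ψ t)) x⟫_ℝ + ν' * ⟪w t x, laplacian (fourierTruncate M (ψ t)) x⟫_ℝ +
        ⟪f' x, fourierTruncate M (ψ t) x⟫_ℝ)) + ∫ x, ⟪w 0 x, fourierTruncate M (ψ 0) x⟫_ℝ = 0 :=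
  galerkin_weak_identity_of_modewise hf hwm hw hY hmode hT hψ hdiv

end Summit.AnomalousDissipation.AnomalousDissipation.Theorems.EnsembleRealization
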